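import Literature.AlgebraicGeometry.Motives.HodgeThetaSubalgebraUnitaryTwoThree
import Literature.AlgebraicGeometry.Motives.HodgeThetaSubalgebraSymplecticRankTenSkew
import Literature.AlgebraicGeometry.Motives.HodgeLieRigid
import HarnessLib

/-!
# The unitary `Θ`-subalgebra programme beyond coprime multiplicities — socket lemmas: propagation from `Lie Hg` to every
# admissible algebra, commutation with `Θ` detected on `W`, rationality of the trace form (Ribet 1983 Thm. 3 / Moonen–Zarhin
# 1999 (2.3)–(2.4), Type IV(1,1) with multiplicities `(n′, n″)`; Deligne LNM 900 I Prop. 3.4)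

Topic `Literature/AlgebraicGeometry/Motives` (namespace `Literature.AlgebraicGeometry.Motives.HodgeStructure`).  Theorems only
(no definition, no named fact; D-0026).  Written for the cell `pub-hodgeav-hg6` (req-37 (A) row 2, TABLE X row 8-`(4,2)`: simple
abelian SIXFOLDS with `End⁰ = k` imaginary quadratic acting with multiplicities `(4,2)`; brick U1b of the `(4,2)` programme,
lead g2 2026-08-28T21:14:20Z / 21:16:44Z; honest framing of that cell: HC / HC_AV / HC_CM / H2 NOT proved — THIS file is
unconditional Hodge–Lie linear algebra and discharges no hypothesis of the cell's cover).

SETTING (as in `HodgeThetaSubalgebraUnitary` / `…UnitaryTwoThree`).  `H` effective polarized of weight `1` on `V`, `ψ` a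
polarization, `φ ∈ E = End_Hdg(V)` with `φ² = −d` (`d > 0`), `E = ℚ + ℚφ` (`End⁰ = k = ℚ(√−d)`), `μ² = −d`, `W = ker(φ_ℂ − μ)`;
an ADMISSIBLE `𝔤 ⊆ End_ℚ(V)`: rational, bracket-closed, commuting with `E`, `ψ`-skew, with `Θ ∈ 𝔤_ℂ`.  The coprime cases
`(m,1)` (THEOREM L′) and `(2,3)` (THEOREM L″) conclude `𝔤_ℂ = 𝔲_k(V,ψ)_ℂ` from a COMPLEX core on `W`; for `(4,2)` the complex
core alone is false (the irreducible skeleton `ℂ ⊕ 𝔰𝔩₂⊗1 ⊕ 1⊗𝔰𝔩₃` on `ℂ² ⊗ ℂ³` carries a `(4,2)` grading element) and the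
exclusion is ARITHMETIC (the radical kill `HodgeThetaSubalgebraRadicalKill`).  This file supplies the three shape-independent
lemmas such an argument plugs into:

* **`UnitaryTheta.mem_spanC_of_commute_of_skew_of_hodgeLieC`** — PROPAGATION: if `Lie Hg(H) ⊗ ℂ` contains every `φ_ℂ`-commuting
  `ψ_ℂ`-skew operator, then so does `𝔤_ℂ` for EVERY admissible `𝔤` (Deligne's minimality `hodgeLie_rigid` applied to
  `𝔤 ∩ Lie Hg`; the unitary twin of `mem_spanC_of_skew_of_hodgeLieC` of `HodgeLieWeightOneRankEightSymplectic`).  Consequently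
  the `(n′,n″)` theorem need only be proved for `𝔤 = Lie Hg`, where minimality and `ℚ`-simplicity tools are available, and the
  tensor theorem L‴ for the annihilator algebras `annLie` follows as in the `(m,1)` / `(2,3)` files.
* **`UnitaryTheta.mul_theta_comm_of_forall_mem_eigenspace`** — COMMUTATION DETECTED ON `W`: an element of `𝔤_ℂ` commuting with
  `Θ` on `W` commutes with `Θ` (the commutator is `φ_ℂ`-commuting, `ψ_ℂ`-skew and zero on `W`, hence zero:
  `UnitaryTheta.eq_zero_of_forall_mem_eigenspace`) — the bridge from a complex core's clause «the radical commutes with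
  `T = Θ|_W`» to the hypothesis of `ThetaSubalgebra.eq_zero_of_radical_of_forall_radical_commute_theta`.
* **`trace_baseChange_mul_baseChange_mem_range`** — RATIONALITY of the trace form on rational pairs:
  `tr_{V_ℂ}(X_ℂ Y_ℂ) = tr_V(XY) ∈ ℚ` (`LinearMap.trace_baseChange`), the `hrat` witness pattern of `spanC_exists_rational_radical`.

## References

* [Ribet1983] K. A. Ribet, *Hodge classes on certain types of abelian varieties*, Amer. J. Math. 105 (1983), Thm. 3.
* [MoonenZarhin1999LowDim] B. Moonen, Yu. Zarhin, Math. Ann. 315 (1999), §2 (2.3)–(2.4), §3 (3.1).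
* [Deligne1982HodgeCycles] P. Deligne, *Hodge cycles on abelian varieties*, LNM 900 (1982), I §3 Prop. 3.4 (minimality), 3.6.
* [Gordon1997] B. B. Gordon, *A survey of the Hodge conjecture for abelian varieties*, Thm. 6.3 (3) and pp. 18–19.
-/

noncomputable section

open scoped TensorProduct

namespace Literature.AlgebraicGeometry.Motives

namespace HodgeStructure

universe u

variable {V : Type u} [AddCommGroup V] [Module ℚ V] {n : ℤ}

/-! ## §1 Propagation from `Lie Hg` to every admissible algebra -/

/-- **If `Lie Hg(H) ⊗ ℂ` contains every `φ_ℂ`-commuting `ψ_ℂ`-skew operator, then so does `𝔤_ℂ` for every admissible `𝔤`**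
(rational, bracket-closed, with `Θ ∈ 𝔤_ℂ`).  PROOF: `𝔞 := 𝔤 ∩ Lie Hg` is bracket-closed with `Θ ∈ 𝔞_ℂ` (`spanC_inf_eq`,
`mem_hodgeLieC_of_forall_piece`), so Deligne's minimality (`hodgeLie_rigid`) gives `Lie Hg ≤ 𝔞 ≤ 𝔤`.  (Deligne LNM 900 I 3.4:
`Hg` is the smallest `ℚ`-group whose complex points contain the Hodge cocharacter; Moonen–Zarhin (2.3): `Hg(X) = U_F(V,ψ)`.)
[cite: Deligne1982HodgeCycles, I §3 Prop. 3.4] [cite: MoonenZarhin1999LowDim, §2 (2.3) and §3 (3.1)] -/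
theorem UnitaryTheta.mem_spanC_of_commute_of_skew_of_hodgeLieC [Module.Finite ℚ V] [HodgeTensorFacts.{u, u}]
    (H : HodgeStructure V n) (ψ : H.Polarization) {φ : Module.End ℚ V}
    (hsp : ∀ Y : Module.End ℂ (ℂ ⊗[ℚ] V), Y * φ.baseChange ℂ = φ.baseChange ℂ * Y →
      (∀ x y, ψ.form.baseChange ℂ (Y x) y + ψ.form.baseChange ℂ x (Y y) = 0) → Y ∈ H.hodgeLieC)
    (𝔤 : Submodule ℚ (Module.End ℚ V)) (hbr : ∀ X ∈ 𝔤, ∀ X' ∈ 𝔤, X * X' - X' * X ∈ 𝔤)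
    {Θ : Module.End ℂ (ℂ ⊗[ℚ] V)} (hΘ : ∀ p, ∀ x ∈ H.piece p (n - p), Θ x = ((2 * p - n : ℤ) : ℂ) • x)
    (hΘ𝔤 : Θ ∈ spanC 𝔤) {Y : Module.End ℂ (ℂ ⊗[ℚ] V)} (hYφ : Y * φ.baseChange ℂ = φ.baseChange ℂ * Y)
    (hYskew : ∀ x y, ψ.form.baseChange ℂ (Y x) y + ψ.form.baseChange ℂ x (Y y) = 0) : Y ∈ spanC 𝔤 := by
  have hΘ𝔥 : Θ ∈ spanC H.hodgeLie := (hodgeLieC_eq_spanC H) ▸ H.mem_hodgeLieC_of_forall_piece hΘ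
  have hΘ𝔞 : Θ ∈ spanC (𝔤 ⊓ H.hodgeLie) := by rw [spanC_inf_eq]; exact ⟨hΘ𝔤, hΘ𝔥⟩
  have hbr𝔞 : ∀ X ∈ 𝔤 ⊓ H.hodgeLie, ∀ X' ∈ 𝔤 ⊓ H.hodgeLie, X * X' - X' * X ∈ 𝔤 ⊓ H.hodgeLie :=
    fun X hX X' hX' => ⟨hbr X hX.1 X' hX'.1, H.commutator_mem_hodgeLie hX.2 hX'.2⟩
  have h𝔥le : H.hodgeLie ≤ 𝔤 ⊓ H.hodgeLie := hodgeLie_rigid H ⟨ψ⟩ (𝔤 ⊓ H.hodgeLie) inf_le_right hbr𝔞 ⟨Θ, hΘ𝔞, hΘ⟩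
  have hY𝔥 : Y ∈ H.hodgeLieC := hsp Y hYφ hYskew
  rw [hodgeLieC_eq_spanC] at hY𝔥
  exact spanC_mono (h𝔥le.trans inf_le_left) hY𝔥

/-! ## §2 Commutation with `Θ` is detected on `W` -/

/-- **An element of `𝔤_ℂ` commuting with `Θ` on `W = ker(φ_ℂ − μ)` commutes with `Θ`** (admissible `𝔤`: commuting with `E`,
`ψ`-skew, `Θ ∈ 𝔤_ℂ`).  The commutator `[Z, Θ] ∈ 𝔤_ℂ` commutes with `φ_ℂ`, is `ψ_ℂ`-skew and vanishes on `W`, so it vanishes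
(`UnitaryTheta.eq_zero_of_forall_mem_eigenspace`: `W' = conj W` is the `ψ_ℂ`-dual of `W`).  In the `(4,2)` programme this turns
the complex core's clause «the radical of `tr_W − c·κ` commutes with `T = Θ|_W`» into the hypothesis of the radical kill.
[cite: Deligne1982HodgeCycles, I §3 Prop. 3.4 and 3.6] [cite: Gordon1997, §6 (pp. 18–19)] -/
theorem UnitaryTheta.mul_theta_comm_of_forall_mem_eigenspace [Module.Finite ℚ V] [Nontrivial V] (H : HodgeStructure V n)
    (ψ : H.Polarization) {φ : Module.End ℚ V} (hφE : φ ∈ H.endAlg) {d : ℚ} (hd : 0 < d) (hφ2 : φ * φ = -(d • 1))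
    (hE : ∀ a ∈ H.endAlg, ∃ x y : ℚ, a = x • 1 + y • φ) {μ : ℂ} (hμ : μ ^ 2 = -(d : ℂ))
    (𝔤 : Submodule ℚ (Module.End ℚ V)) (hbr : ∀ X ∈ 𝔤, ∀ X' ∈ 𝔤, X * X' - X' * X ∈ 𝔤)
    {Θ : Module.End ℂ (ℂ ⊗[ℚ] V)} (hΘ𝔤 : Θ ∈ spanC 𝔤)
    (hcomm : ∀ X ∈ 𝔤, ∀ a : H.endAlg, X * (a : Module.End ℚ V) = (a : Module.End ℚ V) * X)
    (hskew : ∀ X ∈ 𝔤, ∀ v w, ψ.form (X v) w + ψ.form v (X w) = 0)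
    {Z : Module.End ℂ (ℂ ⊗[ℚ] V)} (hZ : Z ∈ spanC 𝔤)
    (hZW : ∀ w ∈ Module.End.eigenspace (φ.baseChange ℂ) μ, Z (Θ w) = Θ (Z w)) : Z * Θ = Θ * Z := by
  have hD𝔤 : Z * Θ - Θ * Z ∈ spanC 𝔤 := commutator_mem_spanC hbr hZ hΘ𝔤
  have hD := UnitaryTheta.eq_zero_of_forall_mem_eigenspace H ψ hφE hd hφ2 hE hμ (D := Z * Θ - Θ * Z)
    (UnitaryTheta.commute_of_mem_spanC H hφE hcomm hD𝔤)
    (fun x y => ThetaSubalgebra.formBaseChange_add_eq_zero_of_mem_spanC ψ hskew hD𝔤 x y)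
    (fun w hw => by rw [LinearMap.sub_apply, Module.End.mul_apply, Module.End.mul_apply, hZW w hw, sub_self])
  rwa [sub_eq_zero] at hD

/-- **The same with `Θ` replaced by any `T ∈ 𝔤_ℂ`**: two elements of `𝔤_ℂ` commute as soon as they commute on `W`
(determination on `W`). [cite: Deligne1982HodgeCycles, I §3 Prop. 3.4] -/
theorem UnitaryTheta.mul_comm_of_forall_mem_eigenspace [Module.Finite ℚ V] [Nontrivial V] (H : HodgeStructure V n)
    (ψ : H.Polarization) {φ : Module.End ℚ V} (hφE : φ ∈ H.endAlg) {d : ℚ} (hd : 0 < d) (hφ2 : φ * φ = -(d • 1))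
    (hE : ∀ a ∈ H.endAlg, ∃ x y : ℚ, a = x • 1 + y • φ) {μ : ℂ} (hμ : μ ^ 2 = -(d : ℂ))
    (𝔤 : Submodule ℚ (Module.End ℚ V)) (hbr : ∀ X ∈ 𝔤, ∀ X' ∈ 𝔤, X * X' - X' * X ∈ 𝔤)
    (hcomm : ∀ X ∈ 𝔤, ∀ a : H.endAlg, X * (a : Module.End ℚ V) = (a : Module.End ℚ V) * X)
    (hskew : ∀ X ∈ 𝔤, ∀ v w, ψ.form (X v) w + ψ.form v (X w) = 0)
    {Z T : Module.End ℂ (ℂ ⊗[ℚ] V)} (hZ : Z ∈ spanC 𝔤) (hT : T ∈ spanC 𝔤)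
    (hZW : ∀ w ∈ Module.End.eigenspace (φ.baseChange ℂ) μ, Z (T w) = T (Z w)) : Z * T = T * Z := by
  have hD𝔤 : Z * T - T * Z ∈ spanC 𝔤 := commutator_mem_spanC hbr hZ hT
  have hD := UnitaryTheta.eq_zero_of_forall_mem_eigenspace H ψ hφE hd hφ2 hE hμ (D := Z * T - T * Z)
    (UnitaryTheta.commute_of_mem_spanC H hφE hcomm hD𝔤)
    (fun x y => ThetaSubalgebra.formBaseChange_add_eq_zero_of_mem_spanC ψ hskew hD𝔤 x y)
    (fun w hw => by rw [LinearMap.sub_apply, Module.End.mul_apply, Module.End.mul_apply, hZW w hw, sub_self])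
  rwa [sub_eq_zero] at hD

/-! ## §3 Rationality of the trace form on rational pairs -/

/-- **`tr_{V_ℂ}(X_ℂ Y_ℂ) = tr_V(XY)`, a rational number** — the `hrat` witness of `spanC_exists_rational_radical` for the trace
part of the invariant forms `tr − c·κ` (Hoffman–Kunze: traces are defined over the field of the matrix entries).
[cite: Deligne1982HodgeCycles, I §3 Prop. 3.6] -/
theorem trace_baseChange_mul_baseChange_mem_range [Module.Finite ℚ V] (X Y : Module.End ℚ V) :
    ∃ q : ℚ, LinearMap.trace ℂ (ℂ ⊗[ℚ] V) (X.baseChange ℂ * Y.baseChange ℂ) = (q : ℂ) := by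
  refine ⟨LinearMap.trace ℚ V (X * Y), ?_⟩
  rw [← LinearMap.baseChange_mul, LinearMap.trace_baseChange]
  rfl

end HodgeStructure

end Literature.AlgebraicGeometry.Motives

end
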